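import Literature.Analysis.FluidPDE.KwonPerturbedSuitable
import Literature.Analysis.FluidPDE.DistributionalPressurePoisson
import Literature.Analysis.FluidPDE.WeakSolutionProofs
import HarnessLib

/-!
# Kwon's perturbed Navier–Stokes system: restriction of the domain and the pressure equation

Analysis/FluidPDE proof file (theorems only; no definitions, no named facts) over the accepted
notion `Kwon2023.IsPerturbedSuitableOn` (`KwonPerturbedSuitable.lean`: H. Kwon, *The role of
the pressure in the regularity theory for the Navier–Stokes equations*, J. Differential
Equations 357 (2023) = arXiv:2104.03160, Def. 2.4 — suitable weak solutions of the perturbed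
system `∂ₜv + λ(v·∇)v + (v·∇)h + (h·∇)v + ∇q = Δv + f`, `div v = div h = div f = 0` (gen.NS) on an
open space–time region `O`). Two tools that every proof of Kwon's ε-regularity criterion
(Thm. 3.1; the hypothesis `h31` of the accepted
`kwon2023_velocity_epsilon_regularity_of_lemma25_of_thm31`, `PressureFreeEpsilonRegularityAssembly.lean`)
uses, whichever scheme it follows:

* `Kwon2023.IsPerturbedSuitableOn.mono` — restriction to an open `O' ≤ O` (all conjuncts are
  global classes on `O`, monotone in the domain, or distributional identities tested against
  `C_c^∞(O') ⊆ C_c^∞(O)` whose integrands vanish on `O ∖ O'`); the pattern of the accepted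
  `IsDistributionalNSSolutionOn.mono_holds` / `RRS2016.IsSuitablePair.mono`.
* `Kwon2023.IsPerturbedSuitableOn.pressureEq` — **the pressure equation of (gen.NS)**,
  `-Δq = ∂ᵢ∂ⱼ(λ vᵢvⱼ + hᵢvⱼ + vᵢhⱼ)` in `𝒟'(O)`, in weak form
  `∫∫_O (λ D²θ(v,v) + D²θ(v,h) + D²θ(h,v) + q Δθ) = 0` for every scalar test function `θ` on `O`
  (Kwon, proof of Lemma 3.3, the display (3.5) "`-ΔP_i = ε_i div div(λ V_i ⊗ V_i + H_i ⊗ V_i +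
  V_i ⊗ H_i)` on `Q₁`. Here, we used `div div(V_i ⊗ λ(v_i)_{Q₁}) = div div(H_i ⊗ (v_i)_{Q₁}) = 0`
  because … both `V_i` and `H_i` are divergence-free", arXiv p. 11; it is the divergence of the
  momentum equation, using `div v = div h = div f = 0`). Proof exactly as the accepted
  `IsDistributionalNSSolutionOn.integral_hessian_add_pressure_laplacian_eq_zero`
  (`DistributionalPressurePoisson.lean`, Lemarié-Rieusset (13.19)): test the momentum clause with
  the gradient field `ψ = ∇θ`; `∂ₜψ = ∇∂ₜθ` and `Δψ = ∇Δθ` pair to zero with the weakly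
  divergence-free `v`, `⟪f, ∇θ⟫` integrates to zero (`div f = 0`), `div ψ = Δθ`, and
  `⟪w, (u·∇)∇θ⟫ = D²θ(u, w)`. The force must be locally integrable on `O` for the pairing
  `∫∫ ⟪f, ∇θ⟫` to split off; this is recorded as a hypothesis (`Def. 2.4` has
  `f ∈ L¹_t L²_x(O)`, which implies it).

## Mathlib / tree search

Reused: `inner_fderiv_gradient_apply`, `laplacian_gradient`,
`IsSpaceTimeTestOn.timeDeriv_gradient/timeDeriv_isSpaceTimeTestOn/laplacian_isSpaceTimeTestOn/
gradient_isSpaceTimeTestOn` (`DistributionalPressurePoisson`), `divergence_gradient`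
(`PressurePoisson`), `integrable_inner_of_locallyIntegrableOn`,
`integral_sub_eq_self_of_integral_eq_zero`, `IsSpaceTimeTestOn.continuous_gradient_field`
(`SuitableWeakPressure`), `HasWeakSpatialGradientOn.mono` (`SuitableWeak`). `lean search
'IsPerturbedSuitableOn'`: the definition file and the §4 assembly only.

## References

* H. Kwon, J. Differential Equations 357 (2023) 1–31 = arXiv:2104.03160: Def. 2.4 (p. 7),
  proof of Lemma 3.3, (3.5) (p. 11). [Kwon2023RolePressure]
* P. G. Lemarié-Rieusset, *The Navier–Stokes Problem in the 21st Century*, CRC Press (2016),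
  (13.19) p. 461 (the case `h = 0`). [LemarieRieusset2016]
-/

noncomputable section

open MeasureTheory Set Function Filter Topology TopologicalSpace Metric InnerProductSpace
open scoped ENNReal NNReal RealInnerProductSpace Laplacian

namespace Literature.Analysis.FluidPDE

variable {E : Type*} [NormedAddCommGroup E] [InnerProductSpace ℝ E] [FiniteDimensional ℝ E]
  [MeasurableSpace E] [BorelSpace E]

omit [MeasurableSpace E] [BorelSpace E] [FiniteDimensional ℝ E] in
/-- Bilinear form of the accepted `inner_fderiv_gradient_apply`:
`⟪w, D(∇θ)(x) v⟫ = D²θ(x)(v, w)` for `θ ∈ C²`. [folklore] -/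
private theorem inner_fderiv_gradient_apply_two [CompleteSpace E] {θ : E → ℝ}
    (hθ : ContDiff ℝ 2 θ) (x v w : E) :
    ⟪w, fderiv ℝ (gradient θ) x v⟫ = fderiv ℝ (fderiv ℝ θ) x v w := by
  set L : (E →L[ℝ] ℝ) →L[ℝ] E :=
    (InnerProductSpace.toDual ℝ E).symm.toContinuousLinearEquiv.toContinuousLinearMap with hL
  have hLapp : ∀ φ : E →L[ℝ] ℝ, L φ = (InnerProductSpace.toDual ℝ E).symm φ := fun φ => rfl
  have hd : DifferentiableAt ℝ (fderiv ℝ θ) x :=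
    ((hθ.fderiv_right (m := 1) le_rfl).differentiable one_ne_zero) x
  have h1 : gradient θ = fun y => L (fderiv ℝ θ y) := rfl
  have h2 : HasFDerivAt (fun y => L (fderiv ℝ θ y)) (L.comp (fderiv ℝ (fderiv ℝ θ) x)) x :=
    L.hasFDerivAt.comp x hd.hasFDerivAt
  rw [h1, h2.fderiv, ContinuousLinearMap.comp_apply, hLapp, real_inner_comm,
    InnerProductSpace.toDual_symm_apply]

namespace Kwon2023.IsPerturbedSuitableOn

variable {O O' : Opens (ℝ × E)} {lam : ℝ} {h f v : ℝ → E → E} {Dh : ℝ → E → E →L[ℝ] E}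
  {q : ℝ → E → ℝ}

/-- **Restriction of the domain.** A suitable weak solution of the perturbed system (gen.NS) in
the sense of Kwon's Def. 2.4 on `O` is one on every open `O' ≤ O`: the global classes
(`v ∈ L^∞_t L²_x`, `∇v ∈ L²`, `q ∈ L^{3/2}`, `h ∈ L²_t L^∞_x`, `f ∈ L¹_t L²_x`, written with the
indicator of the domain) are monotone in the domain, the weak spatial gradients restrict, and the
distributional identities (`div v = div h = div f = 0`, the momentum equation, the local energy
inequality) against test functions on `O'` are instances of those on `O`, the weak integrands
vanishing on `O ∖ O'`. [cite: Kwon2023RolePressure, Def. 2.4 (arXiv p. 7)] -/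
theorem mono (hs : IsPerturbedSuitableOn O lam h Dh f v q) (hle : O' ≤ O) :
    IsPerturbedSuitableOn O' lam h Dh f v q := by
  have hQs : ((O' : Opens (ℝ × E)) : Set (ℝ × E)) ⊆ (O : Set (ℝ × E)) := hle
  -- the three divergence constraints restrict in the same way
  have hdiv : ∀ {w : ℝ → E → E},
      (∀ θ : ℝ → E → ℝ, IsSpaceTimeTestOn O θ →
        ∫ z in (O : Set (ℝ × E)), ⟪w z.1 z.2, gradient (θ z.1) z.2⟫ = 0) →
      ∀ θ : ℝ → E → ℝ, IsSpaceTimeTestOn O' θ →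
        ∫ z in (O' : Set (ℝ × E)), ⟪w z.1 z.2, gradient (θ z.1) z.2⟫ = 0 := by
    intro w hw θ hθ
    have key := hw θ (hθ.mono hle)
    rw [setIntegral_eq_of_subset_of_forall_sdiff_eq_zero O.isOpen.measurableSet hQs] at key
    · exact key
    · rintro ⟨t, x⟩ hz
      have hg : gradient (θ t) x = 0 := by
        rw [gradient, hθ.fderiv_slice_eq_zero hz.2, map_zero]
      simp [hg]
  refine
    { locallyIntegrableOn := hs.locallyIntegrableOn.mono_set hQs
      locallyIntegrableOn_sq := hs.locallyIntegrableOn_sq.mono_set hQs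
      energyClass := ?_
      aestronglyMeasurable_pressure :=
        hs.aestronglyMeasurable_pressure.mono_measure (Measure.restrict_mono hQs le_rfl)
      locallyIntegrableOn_pressure := hs.locallyIntegrableOn_pressure.mono_set hQs
      pressure := (lintegral_mono_set hQs).trans_lt hs.pressure
      drift := hs.drift.mono hle
      driftClass := ?_
      drift_divFree := hdiv hs.drift_divFree
      aestronglyMeasurable_force :=
        hs.aestronglyMeasurable_force.mono_measure (Measure.restrict_mono hQs le_rfl)
      forceClass := ?_
      force_divFree := hdiv hs.force_divFree
      divFree := hdiv hs.divFree
      momentum := ?_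
      localEnergy := ?_ }
  · -- `v ∈ L^∞_t L²_x(O')`
    obtain ⟨C, hC⟩ := hs.energyClass
    refine ⟨C, ?_⟩
    filter_upwards [hC] with t ht
    refine (lintegral_mono fun x => ?_).trans ht
    exact indicator_le_indicator_of_subset hQs (fun _ => zero_le) _
  · -- `h ∈ L²_t L^∞_x(O')`
    refine lt_of_le_of_lt (lintegral_mono fun t => ?_) hs.driftClass
    gcongr
    refine eLpNorm_mono fun x => ?_
    exact norm_indicator_le_of_subset hQs _ _
  · -- `f ∈ L¹_t L²_x(O')`
    refine lt_of_le_of_lt (lintegral_mono fun t => ?_) hs.forceClass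
    gcongr with x
  · -- the momentum equation against test fields on `O'`
    intro ψ hψ
    have key := hs.momentum ψ (hψ.mono hle)
    rw [setIntegral_eq_of_subset_of_forall_sdiff_eq_zero O.isOpen.measurableSet hQs] at key
    · exact key
    · rintro ⟨t, x⟩ hz
      have h1 : deriv (fun s => ψ s x) t = 0 := hψ.deriv_eq_zero hz.2
      have h2 : fderiv ℝ (ψ t) x = 0 := hψ.fderiv_slice_eq_zero hz.2
      have h3 : Δ (ψ t) x = 0 := hψ.laplacian_slice_eq_zero hz.2
      have h4 : ψ t x = 0 := hψ.apply_eq_zero hz.2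
      have h5 : VectorCalculus.divergence (ψ t) x = 0 := by simp [VectorCalculus.divergence, h2]
      simp [h1, convect, h2, h3, h4, h5]
  · -- `∇v ∈ L²(O')` and the local energy inequality
    obtain ⟨G, hG, hG2, hlei⟩ := hs.localEnergy
    exact ⟨G, hG.mono hle, (lintegral_mono_set hQs).trans_lt hG2,
      fun φ hφ hφ0 => hlei φ (hφ.mono hle) hφ0⟩

/-- **The force is locally integrable.** The class `f ∈ L¹_t L²_x(O)` of Def. 2.4 implies
`f ∈ L¹_loc(O)`: on a compact `K ⊆ O`, contained in `ℝ × B̄(0, R)`, Tonelli and Cauchy–Schwarz in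
`x` give `∫∫_K |f| ≤ |B̄(0,R)|^{1/2} ∫ (∫ 1_O |f|²(t, x) dx)^{1/2} dt < ∞`.
[cite: Kwon2023RolePressure, Def. 2.4 (arXiv p. 7)] -/
theorem locallyIntegrableOn_force (hs : IsPerturbedSuitableOn O lam h Dh f v q) :
    LocallyIntegrableOn (uncurry f) (O : Set (ℝ × E)) volume := by
  rw [locallyIntegrableOn_iff O.isOpen.isLocallyClosed]
  intro K hKO hK
  -- a strongly measurable version of `f` on `O`
  obtain ⟨g, hg, hfg⟩ := hs.aestronglyMeasurable_force
  have hfg' : ∀ᵐ z : ℝ × E, z ∈ (O : Set (ℝ × E)) → uncurry f z = g z :=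
    (ae_restrict_iff' O.isOpen.measurableSet).1 hfg
  -- `K ⊆ ℝ × B̄(0, R)`
  obtain ⟨R, hR⟩ : ∃ R : ℝ, Prod.snd '' K ⊆ closedBall (0 : E) R :=
    ((hK.image continuous_snd).isBounded).subset_closedBall 0
  set B : Set E := closedBall (0 : E) R with hB
  set F : ℝ × E → ℝ≥0∞ := fun z => (O : Set (ℝ × E)).indicator (fun z => ‖g z‖ₑ) z with hF
  have hFm : Measurable F := hg.measurable.enorm.indicator O.isOpen.measurableSet
  have hBm : Measurable fun x : E => B.indicator (fun _ => (1 : ℝ≥0∞)) x :=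
    measurable_const.indicator measurableSet_closedBall
  refine ⟨hs.aestronglyMeasurable_force.mono_measure (Measure.restrict_mono hKO le_rfl), ?_⟩
  -- `∫⁻_K ‖f‖ₑ ≤ ∫⁻ 1_B(x) F(t, x)`
  have h1 : ∫⁻ z in K, ‖uncurry f z‖ₑ = ∫⁻ z in K, ‖g z‖ₑ := by
    refine lintegral_congr_ae ?_
    filter_upwards [ae_restrict_of_ae_restrict_of_subset hKO hfg] with z hz
    rw [hz]
  have h2 : ∫⁻ z in K, ‖g z‖ₑ ≤ ∫⁻ z : ℝ × E, B.indicator (fun _ => (1 : ℝ≥0∞)) z.2 * F z := by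
    rw [← lintegral_indicator hK.measurableSet]
    refine lintegral_mono fun z => ?_
    by_cases hz : z ∈ K
    · have hzB : z.2 ∈ B := hR (mem_image_of_mem _ hz)
      rw [indicator_of_mem hz, indicator_of_mem hzB, one_mul]
      simp only [hF, indicator_of_mem (hKO hz), le_refl]
    · rw [indicator_of_notMem hz]
      exact zero_le
  -- Tonelli and Cauchy–Schwarz in `x`
  have h3 : ∫⁻ z : ℝ × E, B.indicator (fun _ => (1 : ℝ≥0∞)) z.2 * F z ≤
      ∫⁻ t : ℝ, ∫⁻ x : E, B.indicator (fun _ => (1 : ℝ≥0∞)) x * F (t, x) := by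
    rw [Measure.volume_eq_prod]
    exact lintegral_prod_le _
  have h4 : ∀ t : ℝ, ∫⁻ x : E, B.indicator (fun _ => (1 : ℝ≥0∞)) x * F (t, x) ≤
      (volume B) ^ (1 / 2 : ℝ) * (∫⁻ x : E, F (t, x) ^ (2 : ℝ)) ^ (1 / 2 : ℝ) := by
    intro t
    have hFt : Measurable fun x : E => F (t, x) := hFm.comp (measurable_prodMk_left (x := t))
    have hcs := ENNReal.lintegral_mul_le_Lp_mul_Lq (volume : Measure E)
      (f := fun x : E => B.indicator (fun _ => (1 : ℝ≥0∞)) x) (g := fun x : E => F (t, x))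
      Real.HolderConjugate.two_two hBm.aemeasurable hFt.aemeasurable
    refine hcs.trans (le_of_eq ?_)
    congr 2
    rw [← lintegral_indicator_one measurableSet_closedBall]
    refine lintegral_congr fun x => ?_
    by_cases hx : x ∈ B
    · rw [indicator_of_mem hx, indicator_of_mem hx, ENNReal.one_rpow, Pi.one_apply]
    · rw [indicator_of_notMem hx, indicator_of_notMem hx, ENNReal.zero_rpow_of_pos (by norm_num)]
  -- the class `f ∈ L¹_t L²_x(O)`, transported to the version `g`
  have h5 : ∫⁻ t : ℝ, (∫⁻ x : E, F (t, x) ^ (2 : ℝ)) ^ (1 / 2 : ℝ) =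
      ∫⁻ t, (∫⁻ x, (O : Set (ℝ × E)).indicator
        (fun z : ℝ × E => ‖f z.1 z.2‖ₑ ^ 2) (t, x)) ^ (1 / 2 : ℝ) := by
    have hae : ∀ᵐ t : ℝ, ∀ᵐ x : E, (t, x) ∈ (O : Set (ℝ × E)) → uncurry f (t, x) = g (t, x) := by
      rw [Measure.volume_eq_prod] at hfg'
      exact Measure.ae_ae_of_ae_prod hfg'
    refine lintegral_congr_ae ?_
    filter_upwards [hae] with t ht
    congr 1
    refine lintegral_congr_ae ?_
    filter_upwards [ht] with x hx
    by_cases hz : ((t, x) : ℝ × E) ∈ (O : Set (ℝ × E))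
    · simp only [hF, indicator_of_mem hz]
      rw [← hx hz, uncurry_apply_pair, ENNReal.rpow_two]
    · simp only [hF, indicator_of_notMem hz]
      exact ENNReal.zero_rpow_of_pos (by norm_num)
  have hBfin : (volume B) ^ (1 / 2 : ℝ) ≠ ∞ :=
    ENNReal.rpow_ne_top_of_nonneg (by norm_num) measure_closedBall_lt_top.ne
  calc ∫⁻ z in K, ‖uncurry f z‖ₑ
      ≤ ∫⁻ t : ℝ, ∫⁻ x : E, B.indicator (fun _ => (1 : ℝ≥0∞)) x * F (t, x) := by
        rw [h1]; exact h2.trans h3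
    _ ≤ ∫⁻ t : ℝ, (volume B) ^ (1 / 2 : ℝ) * (∫⁻ x : E, F (t, x) ^ (2 : ℝ)) ^ (1 / 2 : ℝ) :=
        lintegral_mono h4
    _ = (volume B) ^ (1 / 2 : ℝ) * ∫⁻ t, (∫⁻ x, (O : Set (ℝ × E)).indicator
          (fun z : ℝ × E => ‖f z.1 z.2‖ₑ ^ 2) (t, x)) ^ (1 / 2 : ℝ) := by
        rw [lintegral_const_mul' _ _ hBfin, h5]
    _ < ∞ := ENNReal.mul_lt_top hBfin.lt_top hs.forceClass

/-- **The pressure equation of the perturbed system (gen.NS)** (Kwon 2023, proof of Lemma 3.3,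
(3.5): "`-ΔP_i = ε_i div div(λ V_i ⊗ V_i + H_i ⊗ V_i + V_i ⊗ H_i)` … because … both `V_i` and
`H_i` are divergence-free"; the divergence of the momentum equation). For a suitable weak
solution `(v, q)` of `∂ₜv + λ(v·∇)v + (v·∇)h + (h·∇)v + ∇q = Δv + f`, `div v = div h = div f = 0`,
on `O` in the sense of Def. 2.4, with `f` locally integrable on `O`, and every scalar test
function `θ ∈ C_c^∞(O)`:
`∫∫_O (λ D²θ(v, v) + D²θ(v, h) + D²θ(h, v) + q Δθ) = 0`, i.e.
`-Δq = ∂ᵢ∂ⱼ(λ vᵢvⱼ + hᵢvⱼ + vᵢhⱼ)` in `𝒟'(O)` (`D²θ(a, b) = ∑ᵢⱼ aᵢbⱼ∂ᵢ∂ⱼθ`). Proof: the momentum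
clause with `ψ = ∇θ`; `⟪v, ∂ₜ∇θ⟫ = ⟪v, ∇∂ₜθ⟫`, `⟪v, Δ∇θ⟫ = ⟪v, ∇Δθ⟫` and `⟪f, ∇θ⟫` integrate to
zero by `div v = 0`, `div f = 0`; `div ∇θ = Δθ`; `⟪w, (u·∇)∇θ⟫ = D²θ(u, w)`.
[cite: Kwon2023RolePressure, proof of Lemma 3.3, (3.5) (arXiv p. 11)] -/
theorem pressureEq (hs : IsPerturbedSuitableOn O lam h Dh f v q)
    (hf : LocallyIntegrableOn (uncurry f) (O : Set (ℝ × E)) volume)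
    {θ : ℝ → E → ℝ} (hθ : IsSpaceTimeTestOn O θ) :
    ∫ z in (O : Set (ℝ × E)),
      (lam * fderiv ℝ (fderiv ℝ (θ z.1)) z.2 (v z.1 z.2) (v z.1 z.2) +
        fderiv ℝ (fderiv ℝ (θ z.1)) z.2 (v z.1 z.2) (h z.1 z.2) +
        fderiv ℝ (fderiv ℝ (θ z.1)) z.2 (h z.1 z.2) (v z.1 z.2) +
        q z.1 z.2 * Δ (θ z.1) z.2) = 0 := by
  haveI : CompleteSpace E := FiniteDimensional.complete ℝ E
  have hu := hs.locallyIntegrableOn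
  -- the gradient test field and the derived scalar tests
  have hψ := hθ.gradient_isSpaceTimeTestOn
  have h1 := hθ.timeDeriv_isSpaceTimeTestOn
  have h2 := hθ.laplacian_isSpaceTimeTestOn
  have hθ2 : ∀ t, ContDiff ℝ 2 (θ t) := fun t => contDiff_infty.1 (hθ.contDiff_slice t) 2
  have hθ3 : ∀ t, ContDiff ℝ 3 (θ t) := fun t => contDiff_infty.1 (hθ.contDiff_slice t) 3
  -- the momentum equation against `ψ = ∇θ`, rewritten pointwise
  have key := hs.momentum _ hψ
  have hpt : ∀ z : ℝ × E,
      ⟪v z.1 z.2, timeDeriv (fun s y => gradient (θ s) y) z.1 z.2⟫ +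
        lam * ⟪v z.1 z.2, convect (v z.1) (fun y => gradient (θ z.1) y) z.2⟫ +
        ⟪h z.1 z.2, convect (v z.1) (fun y => gradient (θ z.1) y) z.2⟫ +
        ⟪v z.1 z.2, convect (h z.1) (fun y => gradient (θ z.1) y) z.2⟫ +
        ⟪v z.1 z.2, Δ (fun y => gradient (θ z.1) y) z.2⟫ +
        q z.1 z.2 * VectorCalculus.divergence (fun y => gradient (θ z.1) y) z.2 +
        ⟪f z.1 z.2, gradient (θ z.1) z.2⟫ =
      (lam * fderiv ℝ (fderiv ℝ (θ z.1)) z.2 (v z.1 z.2) (v z.1 z.2) +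
        fderiv ℝ (fderiv ℝ (θ z.1)) z.2 (v z.1 z.2) (h z.1 z.2) +
        fderiv ℝ (fderiv ℝ (θ z.1)) z.2 (h z.1 z.2) (v z.1 z.2) +
        q z.1 z.2 * Δ (θ z.1) z.2) +
        (⟪v z.1 z.2, gradient (timeDeriv θ z.1) z.2⟫ +
          ⟪v z.1 z.2, gradient (fun y => Δ (θ z.1) y) z.2⟫ +
          ⟪f z.1 z.2, gradient (θ z.1) z.2⟫) := by
    rintro ⟨t, x⟩
    have e1 : timeDeriv (fun s y => gradient (θ s) y) t x = gradient (timeDeriv θ t) x :=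
      hθ.timeDeriv_gradient t x
    have e2 : ∀ a : ℝ → E → E, convect (a t) (fun y => gradient (θ t) y) x =
        fderiv ℝ (gradient (θ t)) x (a t x) := fun a => rfl
    have e3 : Δ (fun y => gradient (θ t) y) x = gradient (fun y => Δ (θ t) y) x :=
      laplacian_gradient (hθ3 t) x
    have e4 : VectorCalculus.divergence (fun y => gradient (θ t) y) x = Δ (θ t) x :=
      divergence_gradient (hθ2 t) x
    simp only
    rw [e1, e2 v, e2 h, inner_fderiv_gradient_apply_two (hθ2 t),
      inner_fderiv_gradient_apply_two (hθ2 t), inner_fderiv_gradient_apply_two (hθ2 t), e3, e4]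
    ring
  simp_rw [hpt] at key
  -- the three extra terms are integrable on `O` and integrate to zero
  obtain ⟨c1, -, z1⟩ := h1.continuous_gradient_field
  obtain ⟨c2, -, z2⟩ := h2.continuous_gradient_field
  obtain ⟨c0, -, z0⟩ := hθ.continuous_gradient_field
  have hK1 : tsupport (uncurry (timeDeriv θ)) ⊆ (O : Set (ℝ × E)) := h1.tsupport_subset
  have hK2 : tsupport (uncurry fun t => Δ (θ t)) ⊆ (O : Set (ℝ × E)) := h2.tsupport_subset
  have hK0 : tsupport (uncurry θ) ⊆ (O : Set (ℝ × E)) := hθ.tsupport_subset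
  have I1 : Integrable (fun z : ℝ × E => ⟪v z.1 z.2, gradient (timeDeriv θ z.1) z.2⟫)
      (volume : Measure (ℝ × E)) :=
    integrable_inner_of_locallyIntegrableOn hu c1 h1.hasCompactSupport hK1 z1
  have I2 : Integrable (fun z : ℝ × E => ⟪v z.1 z.2, gradient (fun y => Δ (θ z.1) y) z.2⟫)
      (volume : Measure (ℝ × E)) :=
    integrable_inner_of_locallyIntegrableOn hu c2 h2.hasCompactSupport hK2 z2
  have I0 : Integrable (fun z : ℝ × E => ⟪f z.1 z.2, gradient (θ z.1) z.2⟫)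
      (volume : Measure (ℝ × E)) :=
    integrable_inner_of_locallyIntegrableOn hf c0 hθ.hasCompactSupport hK0 z0
  have I12 : Integrable (fun z : ℝ × E => ⟪v z.1 z.2, gradient (timeDeriv θ z.1) z.2⟫ +
      ⟪v z.1 z.2, gradient (fun y => Δ (θ z.1) y) z.2⟫)
      ((volume : Measure (ℝ × E)).restrict (O : Set (ℝ × E))) :=
    I1.integrableOn.add I2.integrableOn
  have hg : Integrable (fun z : ℝ × E => ⟪v z.1 z.2, gradient (timeDeriv θ z.1) z.2⟫ +
      ⟪v z.1 z.2, gradient (fun y => Δ (θ z.1) y) z.2⟫ + ⟪f z.1 z.2, gradient (θ z.1) z.2⟫)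
      ((volume : Measure (ℝ × E)).restrict (O : Set (ℝ × E))) := I12.add I0.integrableOn
  have hg0 : ∫ z in (O : Set (ℝ × E)), (⟪v z.1 z.2, gradient (timeDeriv θ z.1) z.2⟫ +
      ⟪v z.1 z.2, gradient (fun y => Δ (θ z.1) y) z.2⟫ + ⟪f z.1 z.2, gradient (θ z.1) z.2⟫) =
      0 := by
    rw [integral_add I12 I0.integrableOn, integral_add I1.integrableOn I2.integrableOn,
      hs.divFree _ h1, hs.divFree _ h2, hs.force_divFree _ hθ]
    ring
  -- subtract them
  have hsub := integral_sub_eq_self_of_integral_eq_zero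
    (F := fun z : ℝ × E =>
      (lam * fderiv ℝ (fderiv ℝ (θ z.1)) z.2 (v z.1 z.2) (v z.1 z.2) +
        fderiv ℝ (fderiv ℝ (θ z.1)) z.2 (v z.1 z.2) (h z.1 z.2) +
        fderiv ℝ (fderiv ℝ (θ z.1)) z.2 (h z.1 z.2) (v z.1 z.2) +
        q z.1 z.2 * Δ (θ z.1) z.2) +
        (⟪v z.1 z.2, gradient (timeDeriv θ z.1) z.2⟫ +
          ⟪v z.1 z.2, gradient (fun y => Δ (θ z.1) y) z.2⟫ +
          ⟪f z.1 z.2, gradient (θ z.1) z.2⟫)) hg hg0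
  rw [key] at hsub
  simp only [add_sub_cancel_right] at hsub
  exact hsub

/-- The pressure equation `-Δq = ∂ᵢ∂ⱼ(λ vᵢvⱼ + hᵢvⱼ + vᵢhⱼ)` in `𝒟'(O)` for a suitable weak
solution of (gen.NS) in the sense of Def. 2.4, with the local integrability of the force supplied
by the class `f ∈ L¹_t L²_x(O)` (`locallyIntegrableOn_force`).
[cite: Kwon2023RolePressure, proof of Lemma 3.3, (3.5) (arXiv p. 11)] -/
theorem pressureEq' (hs : IsPerturbedSuitableOn O lam h Dh f v q)
    {θ : ℝ → E → ℝ} (hθ : IsSpaceTimeTestOn O θ) :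
    ∫ z in (O : Set (ℝ × E)),
      (lam * fderiv ℝ (fderiv ℝ (θ z.1)) z.2 (v z.1 z.2) (v z.1 z.2) +
        fderiv ℝ (fderiv ℝ (θ z.1)) z.2 (v z.1 z.2) (h z.1 z.2) +
        fderiv ℝ (fderiv ℝ (θ z.1)) z.2 (h z.1 z.2) (v z.1 z.2) +
        q z.1 z.2 * Δ (θ z.1) z.2) = 0 :=
  hs.pressureEq hs.locallyIntegrableOn_force hθ

end Kwon2023.IsPerturbedSuitableOn

end Literature.Analysis.FluidPDE

end
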